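import Summits.BirchSwinnertonDyer.Rank1Residual.X12.O11.LocalKernelFiniteAtThreeDischarge
import Summits.BirchSwinnertonDyer.Rank1Residual.PrintCfram.LocalThreeTorsionZpThreeGr
import Summits.BirchSwinnertonDyer.BirchSwinnertonDyer.Theses.PrintCFram
import HarnessLib

/-!
# Route PrintCFram, ty2's discharge interface at `3`: the support item `LocalKernelFiniteThree`
# (stmt-BirchSwinnertonDyer-23007) PROVED BY NAME, and the `@3` crux C1 / child T from the crux r6
# `AnticyclotomicIndexLawThree` ALONE (cell `bsd-print-cfram`, D-0131 (2) PRINT tier, seat ty2 g5;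
# route rev 16, REF A111; companion of `LocalThreeTorsionZpThree.lean` / `LocalThreeTorsionZpThreeGr.lean`)

HONEST FRAMING (cell `bsd-print-cfram`, HOME `run/shared/lean/pub/bsd-print-cfram/`): the cell works the
partition leaf `CornerF ∧ p ramified in the CM field K` in PARTITION currency — a leaf counts only when its
class theorem is in the kernel BY NAME. THEOREMS ONLY (no definition, no named fact, no axiom, no `sorry`).
Nothing about BSD is asserted or booked: the crux r6 `AnticyclotomicIndexLawThree` (the regime-free
torsion-allowing bottom index law (R-EU)₃ᵀ, CONSTRUCTION/OPEN) is displayed as a HYPOTHESIS wherever it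
enters; C1 `CMRamifiedThreeBSD`, its children N/V/T and the leaf stay OPEN.

* §1 `PrintCfram.localKernelFiniteThree : Theses.PrintCFram.LocalKernelFiniteThree` — the support item's
  statement PROVED, typed against the route decl (its body `∀ W [W.IsElliptic], X12.O11.LocalKernelFiniteAtThree W`
  is `X12.O11.forall_localKernelFiniteAtThree`, the model-free discharge of
  `X12/O11/LocalKernelFiniteAtThreeDischarge.lean`: `E(K_v)[p^∞]` finite by Silverman VII.6.3 / Milne I
  Lemma 3.3, then Greenberg's Lemma 3.3 in kernel form). `Summits/…/Theorems` is prover-only (D-0016), so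
  the item is closed by a prover or the planner against THIS decl (`ledger workitem close
  stmt-BirchSwinnertonDyer-23007 --as proved --by Summit.BirchSwinnertonDyer.Rank1Residual.PrintCfram.localKernelFiniteThree`,
  or a one-line re-export under `Theorems/`).
* §2 With the finiteness input discharged, ty2's consumers lose their `hfin` hypothesis:
  `cmRamifiedThreeBSD_of_anticyclotomicIndexLawThree : AnticyclotomicIndexLawThree → CMRamifiedThreeBSD`
  (**C1 ⟸ r6 alone**, through `PrintCfram.cmRamifiedThreeBSD_of_indexLawAtThreeT`, p571282, and the glue
  `cmRamifiedThreeBSDOfRegimes_holds`, p547523), `localThreeTorsionBSDThree_of_anticyclotomicIndexLawThree`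
  (**T ⟸ r6 alone**; V and N ⟸ r6 were already finiteness-free, p571282), and the «zpthree-♮» form
  `cmRamifiedThreeBSD_of_imcGr_of_indexLawGr` (C1 ⟸ class-wide (IMC)₃♮ ∧ class-wide (PR|IMC)₃♮ under GZK,
  p576075's consumer with `hfin` fed). So the registered skeleton «indexlaw3» on item 20371 needs ONE stub
  (r6) instead of four (r5, r4, r6, 23007).

beyond-print theorem: NO. References: [GreenbergLNM1716] §3 Lemma 3.3 (pp. 73–75); [SilvermanAEC2009]
Prop. VII.6.3; [MilneADT2006] I Lemma 3.3; [Miller2011LMS] §1, Def. 1.1 (BSD(E,p) as an equality of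
`p`-adic valuations); cell STATUS planner 22:02:41Z (rev 16), REF 22:06:57Z (A111).
-/

noncomputable section

open WeierstrassCurve Literature.NumberTheory.EllipticCurves Literature.NumberTheory.EllipticCurves.Rank1Residual
  Summit.BirchSwinnertonDyer.Rank1Residual
  Summit.BirchSwinnertonDyer.Rank1Residual.X12.O11
  Summit.BirchSwinnertonDyer.BirchSwinnertonDyer.Theses.PrintCFram

namespace Summit.BirchSwinnertonDyer.Rank1Residual.PrintCfram

/-! ## §1 The support item `LocalKernelFiniteThree` (stmt-BirchSwinnertonDyer-23007), PROVED -/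

/-- **Item `LocalKernelFiniteThree` PROVED** (body verbatim = `X12.O11.forall_localKernelFiniteAtThree`): for
every elliptic `W/ℚ`, at every `3`-frame and every anticyclotomic `ℤ₃`-tower, Greenberg's local kernel
`ker r_𝔭` is finite — model-free (Silverman VII.6.3 / Milne I Lemma 3.3: `E(K_v)` has a torsion-free
subgroup of finite index; Greenberg Lemma 3.3: `#ker r_v ≤ #E(K_v)[3^∞]`).
[cite: GreenbergLNM1716, §3 Lemma 3.3 and its proof (pp. 73–75)] [cite: SilvermanAEC2009, Prop. VII.6.3] -/
theorem localKernelFiniteThree : Summit.BirchSwinnertonDyer.BirchSwinnertonDyer.Theses.PrintCFram.LocalKernelFiniteThree :=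
  fun W _ => localKernelFiniteAtThree_holds W

/-! ## §2 C1 and T from the crux r6 ALONE; the ♮ consumer without its finiteness input -/

/-- **C1 ⟸ r6 alone, BY NAME**: the `@3` crux `Theses.PrintCFram.CMRamifiedThreeBSD` (item 20371) from the
crux `Theses.PrintCFram.AnticyclotomicIndexLawThree` (item 23006) — ty2's
`PrintCfram.cmRamifiedThreeBSD_of_indexLawAtThreeT` with its local-kernel finiteness input discharged by §1.
CONDITIONAL on r6 (displayed); nothing booked. [cite: Miller2011LMS, §1 and Def. 1.1 (arXiv:1010.2431 p. 3)]
[cite: GreenbergLNM1716, §3 Lemma 3.3 and its proof (pp. 73–75)] -/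
theorem cmRamifiedThreeBSD_of_anticyclotomicIndexLawThree
    (h6 : Summit.BirchSwinnertonDyer.BirchSwinnertonDyer.Theses.PrintCFram.AnticyclotomicIndexLawThree) :
    Summit.BirchSwinnertonDyer.BirchSwinnertonDyer.Theses.PrintCFram.CMRamifiedThreeBSD :=
  cmRamifiedThreeBSD_of_indexLawAtThreeT forall_localKernelFiniteAtThree h6

/-- **T ⟸ r6 alone, BY NAME**: the child `Theses.PrintCFram.LocalThreeTorsionBSDThree` (item 20699) from
r6 — ty2's `PrintCfram.localThreeTorsionBSDThree_of_indexLawAtThreeT` with `hfin` discharged.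
CONDITIONAL on r6. [cite: Miller2011LMS, §1 and Def. 1.1 (arXiv:1010.2431 p. 3)]
[cite: GreenbergLNM1716, §3 Lemma 3.3 and its proof (pp. 73–75)] -/
theorem localThreeTorsionBSDThree_of_anticyclotomicIndexLawThree
    (h6 : Summit.BirchSwinnertonDyer.BirchSwinnertonDyer.Theses.PrintCFram.AnticyclotomicIndexLawThree) :
    Summit.BirchSwinnertonDyer.BirchSwinnertonDyer.Theses.PrintCFram.LocalThreeTorsionBSDThree :=
  localThreeTorsionBSDThree_of_indexLawAtThreeT forall_localKernelFiniteAtThree h6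

/-- **«zpthree-♮» without the finiteness input**: C1 from the class-wide defect-complete pair
(IMC)₃♮ ∧ (PR|IMC)₃♮ (the latter under GZK, displayed) — p576075's
`PrintCfram.cmRamifiedThreeBSD_of_imcGr_of_indexLawGr_of_localKernelFinite` with `hfin` fed by §1.
CONDITIONAL on the two `@[conjecture]` carriers; nothing booked. [cite: Miller2011LMS, §1 and Def. 1.1 (arXiv:1010.2431 p. 3)]
[cite: Kolyvagin1990, Thm. A] -/
theorem cmRamifiedThreeBSD_of_imcGr_of_indexLawGr
    (h1 : ∀ (W : WeierstrassCurve ℚ) [W.IsElliptic] [W.IsGloballyMinimal],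
      W.HasCM → CMRamified W 3 → W.analyticRank = 1 → RamifiedCMEllipticUnitIMCAtZpThreeGr W)
    (h2 : rank_eq_analyticRank_of_analyticRank_le_one →
      ∀ (W : WeierstrassCurve ℚ) [W.IsElliptic] [W.IsGloballyMinimal],
      W.HasCM → CMRamified W 3 → W.analyticRank = 1 → RamifiedCMBottomClassIndexLawAtZpThreeGr W) :
    Summit.BirchSwinnertonDyer.BirchSwinnertonDyer.Theses.PrintCFram.CMRamifiedThreeBSD :=
  cmRamifiedThreeBSD_of_imcGr_of_indexLawGr_of_localKernelFinite forall_localKernelFiniteAtThree h1 h2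

end Summit.BirchSwinnertonDyer.Rank1Residual.PrintCfram

end
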